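import Summits.HodgeConjecture.HodgeConjecture.Theorems.F0P3cStCharTSDGLc            -- ★ p851522 (this seat) «DG-LC★» `DGtwo_fst_eventually_eq`; brings ★ DG-FIELD-TWO (`dgFormulaTwo_*`, `exists_unit_rel_iff_isUnit_discr_two`)
import Literature.NumberTheory.Rogawski1990.LocalNormFibreNonsplit                   -- ★ `IsLocalGRegular.separable_finCharpolyTwo`
import Literature.NumberTheory.Rogawski1990.Ch12Sec5Defs                             -- ★ TR dictionary `EllipticData` (field `DH`)
import Literature.LinearAlgebra.Matrix.CharpolyDiscTwinBridge                        -- ★ `isUnit_discr_iff_separable_of_monic`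
import HarnessLib

/-!
# F0 · P3c · line LH6 «StCharTS» — «DH-LC★»: the field pin `DH := DG₂ ∘ Prod.fst` (★ DG-FIELD-TWO letters) makes `D_H` LOCALLY CONSTANT at every `G`-regular point of `H_v` —
# the `hDHlc` hypothesis of ★ S13b `up_eventually_eq_of_upDef` ∕ `upRegularity_lc_of_upDef`, discharged at RUNG0 [Rogawski1990, §4.9 pp. 54–55; §12.5 p. 183]

Cell `pub/hodgecm-mathlib`, crux H413 = `stmt-HodgeConjecture-24833` (lane `--supports … --as helper`), route HCCMUnconditional; seat F0P3-p02 (g20); datum road of the (S-𝔇)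
organ `stub_EllipticPackage`; S-glue for the junction fold of (UPR)-lc (companion of LH4-p01's ★ «DH-STABLE★» `hDHst_of_pin`, SAME pin letters `h0 hu hDHf`).
The letters determine `DG₂` pointwise (`DG₂ = √√(N(discr χ_g)·N(det g)⁻¹)`, §1), so ★ DG-LC `DGtwo_fst_eventually_eq` applies; `G`-regularity of `γ_H` makes `discr χ_g` a unit (§1).
THEOREMS ONLY (no definition ∕ instance ∕ notation ∕ named fact ∕ `sorry`); ★-only imports.
HONEST LABEL: HC_CM is proved only modulo the 7 printed citations (2 remaining named inputs: hLiu418 = `stmt-HodgeConjecture-24832`, h413 = `stmt-HodgeConjecture-24833`)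
until rung 0 closes; this file closes no organ, count-neutral.

* §1 `isUnit_discr_charpoly_fst_of_isLocalGRegular` (`γ_H` `G`-regular ⇒ `discr χ_g ∈ R^×`), `DG₂_eq_dgFormulaTwo` (the letters pin `DG₂` to the closed form);
* §2 HEAD `hDHlc_of_pin`.

## References
* [Rogawski1990] J. D. Rogawski, *Automorphic Representations of Unitary Groups in Three Variables*, Ann. of Math. Stud. 123 (1990): §4.9 pp. 54–55 (`D_H`), §12.5 p. 183, §4.3 p. 42.
* [HarishChandra1999AdmissibleDistributions] Harish-Chandra, *Admissible invariant distributions on reductive p-adic groups* (1999), §17 — the discriminant factor `|D(γ)|^{1/2}`.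
-/

set_option autoImplicit false
-- the mandated namespace has the single-problem summit's repeated segment (`HodgeConjecture.HodgeConjecture`)
set_option linter.dupNamespace false

noncomputable section

open MeasureTheory Filter Topology Polynomial
open NumberField IsDedekindDomain
open scoped NNReal Matrix MatrixGroups
open Literature.NumberTheory.Automorphic Literature.NumberTheory.Automorphic.UnitaryGroup
open Literature.NumberTheory.GaloisRepresentations Literature.NumberTheory.GaloisRepresentations.IsNonarchimedeanLocalField
open Literature.NumberTheory.Rogawski1990

namespace Summit.HodgeConjecture.HodgeConjecture.Cruxes.H413.F0P3cStCharTSDHLc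

variable (L : Type) [Field L] [NumberField L] [IsCMField L] (v : HeightOneSpectrum (𝓞 ↥(maximalRealSubfield L)))

/-! ## §1 `G`-regular ⇒ `discr χ_g` a unit; the letters pin `DG₂` -/

/-- **`γ_H = (g, u)` `G`-regular ⇒ `discr(χ_g)` is a unit** (`χ_g` separable, ★ `IsLocalGRegular.separable_finCharpolyTwo`; ★ `isUnit_discr_iff_separable_of_monic`).
[cite: Rogawski1990, §4.3 p. 42; §3.1 p. 19] -/
theorem isUnit_discr_charpoly_fst_of_isLocalGRegular
    {a : (UnitaryGroup.cmDatum L 2 (Matrix.of fun i j : Fin 2 => if i.val + j.val + 1 = 2 then (1 : L) else 0)).Local v ×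
      (UnitaryGroup.cmDatum L 1 (Matrix.of fun i j : Fin 1 => if i.val + j.val + 1 = 1 then (1 : L) else 0)).Local v}
    (ha : IsLocalGRegular L v a) :
    IsUnit ((a.1.val : GL (Fin 2) (UnitaryGroup.LocalRing L v)).val.charpoly.discr) :=
  (Literature.LinearAlgebra.Matrix.isUnit_discr_iff_separable_of_monic (Matrix.charpoly_monic _)).2 (IsLocalGRegular.separable_finCharpolyTwo L v ha)

/-- **The DG-FIELD-TWO letters pin `DG₂` to the closed form** `√√(N(discr χ_g)·N(det g)⁻¹)`: on a unit discriminant both equal `√√‖u‖` for `u = discr·det⁻¹` (★ `dgFormulaTwo_eq_of_unit_rel`,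
★ `exists_unit_rel_iff_isUnit_discr_two`), otherwise both vanish (★ `dgFormulaTwo_eq_zero_of_not_isUnit_discr`). [cite: Rogawski1990, §4.9 p. 54] [cite: HarishChandra1999AdmissibleDistributions, §17] -/
theorem DG₂_eq_dgFormulaTwo
    (DG₂ : (UnitaryGroup.cmDatum L 2 (Matrix.of fun i j : Fin 2 => if i.val + j.val + 1 = 2 then (1 : L) else 0)).Local v → ℝ)
    (h0 : ∀ γ : (UnitaryGroup.cmDatum L 2 (Matrix.of fun i j : Fin 2 => if i.val + j.val + 1 = 2 then (1 : L) else 0)).Local v,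
      ¬ IsUnit ((γ.val.val.charpoly).discr) → DG₂ γ = 0)
    (hu : ∀ (γ : (UnitaryGroup.cmDatum L 2 (Matrix.of fun i j : Fin 2 => if i.val + j.val + 1 = 2 then (1 : L) else 0)).Local v)
      (u : (UnitaryGroup.LocalRing L v)ˣ),
      (u : UnitaryGroup.LocalRing L v) * (γ.val.val.det) ^ (2 - 1) = (γ.val.val.charpoly).discr →
        DG₂ γ = ((NNReal.sqrt (NNReal.sqrt (unitModulusChar (UnitaryGroup.LocalRing L v) u)) : ℝ≥0) : ℝ))
    (γ : (UnitaryGroup.cmDatum L 2 (Matrix.of fun i j : Fin 2 => if i.val + j.val + 1 = 2 then (1 : L) else 0)).Local v) :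
    DG₂ γ = ((NNReal.sqrt (NNReal.sqrt
        ((∏ w : PlacesOver L v, normAbs (w.1.adicCompletion L) (((γ.val : GL (Fin 2) (UnitaryGroup.LocalRing L v)).val.charpoly.discr) w)) *
          (∏ w : PlacesOver L v, normAbs (w.1.adicCompletion L) (((γ.val : GL (Fin 2) (UnitaryGroup.LocalRing L v)).val.det) w))⁻¹)) : ℝ≥0) : ℝ) := by
  by_cases hd : IsUnit ((γ.val : GL (Fin 2) (UnitaryGroup.LocalRing L v)).val.charpoly.discr)
  · obtain ⟨u, hrel⟩ := (F0P3cStCharTSDGFieldTwo.exists_unit_rel_iff_isUnit_discr_two L v _ γ).2 hd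
    rw [hu γ u hrel, F0P3cStCharTSDGFieldTwo.dgFormulaTwo_eq_of_unit_rel L v _ γ u hrel]
  · rw [h0 γ hd, F0P3cStCharTSDGFieldTwo.dgFormulaTwo_eq_zero_of_not_isUnit_discr L v _ γ hd]

/-! ## §2 HEAD -/

/-- **«DH-LC★» — `D_H` IS LOCALLY CONSTANT AT `G`-REGULAR POINTS under the pin `DH := DG₂ ∘ Prod.fst`** (DG-FIELD-TWO letters `h0`, `hu`, field `hDHf`): the `hDHlc` hypothesis of
★ `F0P3cStCharTSUprLc.up_eventually_eq_of_upDef` verbatim. [cite: Rogawski1990, §4.9 pp. 54–55; §12.5 p. 183] -/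
theorem hDHlc_of_pin {G : Type} [Group G] [TopologicalSpace G] [IsTopologicalGroup G] [MeasurableSpace G]
    [∀ γ : G, MeasurableSpace (G ⧸ Subgroup.centralizer ({γ} : Set G))] [MeasurableSpace (G ⧸ Subgroup.center G)]
    [MeasurableSpace ((UnitaryGroup.cmDatum L 2 (Matrix.of fun i j : Fin 2 => if i.val + j.val + 1 = 2 then (1 : L) else 0)).Local v ×
      (UnitaryGroup.cmDatum L 1 (Matrix.of fun i j : Fin 1 => if i.val + j.val + 1 = 1 then (1 : L) else 0)).Local v)]
    (𝔇 : Ch12Sec5.EllipticData G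
      ((UnitaryGroup.cmDatum L 2 (Matrix.of fun i j : Fin 2 => if i.val + j.val + 1 = 2 then (1 : L) else 0)).Local v ×
        (UnitaryGroup.cmDatum L 1 (Matrix.of fun i j : Fin 1 => if i.val + j.val + 1 = 1 then (1 : L) else 0)).Local v))
    (DG₂ : (UnitaryGroup.cmDatum L 2 (Matrix.of fun i j : Fin 2 => if i.val + j.val + 1 = 2 then (1 : L) else 0)).Local v → ℝ)
    (h0 : ∀ γ : (UnitaryGroup.cmDatum L 2 (Matrix.of fun i j : Fin 2 => if i.val + j.val + 1 = 2 then (1 : L) else 0)).Local v,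
      ¬ IsUnit ((γ.val.val.charpoly).discr) → DG₂ γ = 0)
    (hu : ∀ (γ : (UnitaryGroup.cmDatum L 2 (Matrix.of fun i j : Fin 2 => if i.val + j.val + 1 = 2 then (1 : L) else 0)).Local v)
      (u : (UnitaryGroup.LocalRing L v)ˣ),
      (u : UnitaryGroup.LocalRing L v) * (γ.val.val.det) ^ (2 - 1) = (γ.val.val.charpoly).discr →
        DG₂ γ = ((NNReal.sqrt (NNReal.sqrt (unitModulusChar (UnitaryGroup.LocalRing L v) u)) : ℝ≥0) : ℝ))
    (hDHf : ∀ s, 𝔇.DH s = DG₂ s.1) :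
    ∀ a, IsLocalGRegular L v a → ∀ᶠ a' in 𝓝 a, 𝔇.DH a' = 𝔇.DH a := fun a ha =>
  F0P3cStCharTSDGLc.DGtwo_fst_eventually_eq L v _ 𝔇.DH (fun h => by rw [hDHf h, DG₂_eq_dgFormulaTwo L v DG₂ h0 hu h.1]) a
    (isUnit_discr_charpoly_fst_of_isLocalGRegular L v ha)

end Summit.HodgeConjecture.HodgeConjecture.Cruxes.H413.F0P3cStCharTSDHLc

end
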